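import Literature.MathematicalPhysics.QuantumFieldTheory.Balaban1983to89.B16RLeafRecord13LiveSLaw
import Literature.MathematicalPhysics.QuantumFieldTheory.Balaban1983to89.B14NodeKnitRecord13R
import Literature.MathematicalPhysics.QuantumFieldTheory.Balaban1983to89.B14SeparationOfRecord
import Literature.MathematicalPhysics.QuantumFieldTheory.Balaban1983to89.Node00.Record13SepMixed
import Literature.MathematicalPhysics.QuantumFieldTheory.Balaban1983to89.B16RLeafRecord13Sep

/-!
# `Balaban1983to89.B16RLeafRecord13SepMixed` — YM-DAG nodes N13∕N11 AT node00-def-T's v1.3 SEPARATED (7)-REGULAR-RANGE RECORD (`Node00/Record13SepMixed.lean`):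
# the live-line junction (𝐑-leaf, laws, `densitiesDescribed`, the N11 node `Dag.B14_main`, the (B)-face conjunct `B16.Thm1Printed`, 𝐑 = identity a.e.) RE-KEYED
# from v1.2's `Provisos₁₃Sep` ∕ `datumOfRecord₁₃Sep` ∕ `IsRecordOfRecord₁₃CSep` to `Provisos₁₃SepMixed` ∕ `datumOfRecord₁₃SepMixed` ∕ `IsRecordOfRecord₁₃CSepMixed`
# ([Balaban1988Convergent] p. 244, Thm 1 p. 262; [Balaban1989LargeFieldI] (0.3)–(0.4) p. 176, (i)–(ii) p. 177; [Balaban1989LargeFieldII] Thm 1 p. 355)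

statement-level bookkeeping over published theorems with citation tags; kernel-checked compositions of tree theorems;
nothing here is a claim about the Yang–Mills mass gap.

WHAT THIS FILE RECORDS (seat dag-n11-e g7, trigger (t17) of the lineage: director-ym LINE №142∕№144 ρ1-SEQUENCED — node00-def-T's v1.3 is the SIBLING MODULE
`Node00/Record13SepMixed.lean` (the gate caps a file at 200 000 bytes), token map `Sep ↦ SepMixed` on every §9 name, the row `bg` now over the separated
(7)-regular support `suppOfRecord₁₃SepMixed` (membership ⟨regular support, `Sect2.SeqSeparated`, node00-def-P11's `Sect2.DataSmall7P`, …⟩ after HYP-AUDIT-13);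
plan rev 20 keys the K-class items on the `SepMixed` names).  This lineage's live-line chain reads a proviso hypothesis ONLY through its row `rstep`, which
`Provisos₁₃SepMixed` carries verbatim — so every face of `…B16RLeafRecord13Sep` (p503303) ports by ONE projection, exactly as v1.2's did:

§1  `rstep_of_provisos₁₃SepMixed`; the leaf ∕ laws ∕ `rOperation` reading ∕ a.e. identity ∕ Thm-1-from-(S1ᵀ)-LiveSeq at the selector clause from `h : θ.Provisos₁₃SepMixed F N`
    (suffix `_sepMixed`), and at K0a's re-pin `θ.liveRepin₁₃`.
§2  THE DATUM-LEVEL JUNCTION at `datumOfRecord₁₃SepMixed F N θ h`: `densitiesDescribed_at_record₁₃SepMixed_of_laws` ∕ `_of_liveSel`, the N11 node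
    `b14_main_at_record₁₃SepMixed_of_rOpLeaf` ∕ `_of_liveSel`, the K1-binder shape `b14_main_of_isRecordOfRecord₁₃CSepMixed_datum_of_liveSel`, the (B)-face's first conjunct
    `thm1Printed_datumOfRecord₁₃SepMixed_of_laws_of_liveSel` (full (S1ᵀ)) and `…_of_lawsLive_of_liveSel` (K0a's `LiveSeq` currency, through
    `inductionStep_datumOfRecord₁₃SepMixed_of_tLawLiveSeq_of_liveSel`) — compositions of node00-def-T's v1.3 faces `sect2Form_stage13SepMixed_iff`, `inductionBase_datumOfRecord₁₃SepMixed`,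
    `thm1Printed_datumOfRecord₁₃SepMixed_of_tLaw_rOpLeaf`, `construction_eq_of_isRecordOfRecord₁₃CSepMixed` with this lineage's closed 𝐑-leaf.
§5  the director's row in [III]'s own names (`B14.ThmP245PrintedI`, `B14.RAssumedP244`) at the v1.3 datum, §6 the `IsRecordOfRecord₁₃CSepMixed`-keyed (D, w)-face,
    (v1.2's §7 «support guard = no restriction at a charged sequence» does NOT transfer: the (7)-regularity conjunct is a genuine restriction on the datum `W`;
    only the separation conjunct is automatic there — `…B14SeparationOfRecord.seqSeparated_of_slotsOfRecord₁₃_ne_zero_of_M₁_le_M`, unchanged),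
§8  ★ N11's per-level share ON PRINT'S RANGE: (live ⇒ separated is `…B16RLeafRecord13Sep.seqSeparated_of_liveSeq₁₃`, cited) — `sLaw₁₃_succ_of_tLawLiveSep_of_liveSel_sepMixed` ∕
    `sLaw₁₃_all_of_thmP245LiveSep_of_liveSel_sepMixed` — the §2 dichotomy demanded only at live ∧ `Sect2.SeqSeparated` sequences (`0 < M₁ ≤ M`).
§3  At the re-pin `θ.liveRepin₁₃` and §4 at the witnesses `theta13LiveOfRecord` ∕ `theta13LiveOfNumerics` ∕ `theta13OfThm1` ∕ `theta13OfThm1C` with the datum binder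
    `h : (…).Provisos₁₃SepMixed F N` (admissibility and signs discharged by the numerals of record).

HONEST SCOPE (unchanged): on the live line 𝐑 integrates out only terms of zero fibre mass ([I] p. 177 (i)–(ii)); [B16] Theorem 1's 𝐑-construction is NOT exercised; the
(S1ᵀ) slot (N11's analysis, [III] §3 — at live witnesses with `εreg` in [B7] Prop. 2's range its first instance and `SLaw₁₃ … 1` itself FAIL in the tree, seat dag-n11-d's
`…N11SmallRegFirstStepFails` and this seat's `…N11LiveRecordFirstLevelFails`; the cure is the 12a∕def-T 𝐓-image junction re-type) and `Provisos₁₃SepMixed` itself (K0)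
are HYPOTHESES; nothing of Bałaban is asserted; count-neutral.
-/

noncomputable section

open MeasureTheory
open scoped BigOperators Matrix.Norms.L2Operator

namespace Literature.MathematicalPhysics.QuantumFieldTheory.Balaban1983to89.B16RLeafRecord13SepMixed

open T4Continuum T4DatumAssembly Node00 B14.Eq218Concrete DagBinding
open B16RLeafRecord11 B16RLeafRecord12 B16RLeafRecord12Live B16RLeafRecord12AtLive
open B16RLeafRecord13Live B16RLeafRecord13AtLive B16RLeafRecord13LiveRstep
open B14NodeKnitTowerDatum (densitiesDescribed_iff_core b14_main_at_datumOfTower_of_propTower)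

variable (F : T4Family) (N : ℕ) [NeZero N]

/-! ## §1  The live-line chain from `h : θ.Provisos₁₃SepMixed F N` (one projection: row `rstep`) -/

section Leaf

variable (θ : Stage13Params F N) (p : B12.RunParams)

variable {F N θ} in
/-- **`Provisos₁₃SepMixed` carries the row `rstep`** (verbatim field; the only row the live-line chain reads). [cite: Balaban1989LargeFieldI, (0.3) p.176 (bookkeeping)] -/
theorem rstep_of_provisos₁₃SepMixed (h : θ.Provisos₁₃SepMixed F N) :
    ∀ (p : B12.RunParams) (k : ℕ) [DecidableEq (PBond (F.P p.K) (k + 1))], k < p.K →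
      (towerRepOfRecord F N θ.ν θ.τ9 (slotsTOfRecord F N θ.ν θ.τ9 (EOfRecord₁₃ F N θ) (wOfRecord₉ F N θ.toStage9Params) θ.ppSel)
        θ.ppSel p (gOfRecord₁₃ F N θ p) (k + 1)).toRepData.ProvisosInt :=
  fun p k _ hk => h.rstep p k hk

/-- **★ THE 𝐑-LEAF OF RECORD AT THE LIVE SELECTOR FROM `Provisos₁₃SepMixed`, ADMISSIBILITY AND THE SIGNS.** [cite: Balaban1988Convergent, p.244, Thm 2 p.263; Balaban1989LargeFieldI, (0.3) p.176, p.177 (i)–(ii); Balaban1989LargeFieldII, Thm 1 p.355 (not exercised)] -/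
theorem rOpLeaf_VOfRecord₁₃_of_liveSel_sepMixed (h : θ.Provisos₁₃SepMixed F N) (hθ : θ.Admissible F N) (hκ : 0 ≤ θ.s2.lf.κ) (hE₀ : 0 ≤ θ.s2.lf.E₀)
    (hB₀ : 0 ≤ θ.s2.lf.B₀) (hsel : θ.ppSel = ppSelLiveOfRecord F N θ.ν θ.τ9 (EOfRecord₁₃ F N θ) (wOfRecord₉ F N θ.toStage9Params)) :
    ROpLeaf (VOfRecord₁₃ F N θ p) :=
  rOpLeaf_VOfRecord₁₃_of_liveSel_of_rstep F N θ p (rstep_of_provisos₁₃SepMixed h) hθ hκ hE₀ hB₀ hsel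

/-- **The (R₁₃) slot in law form at the live selector from `Provisos₁₃SepMixed`** (`hR13` ∕ `rRow` of the Stage-13 knits). [cite: Balaban1988Convergent, p.244 (bookkeeping); Balaban1989LargeFieldII, Thm 1 p.355 (not exercised)] -/
theorem laws₁₃_of_liveSel_sepMixed (h : θ.Provisos₁₃SepMixed F N) (hθ : θ.Admissible F N) (hκ : 0 ≤ θ.s2.lf.κ) (hE₀ : 0 ≤ θ.s2.lf.E₀) (hB₀ : 0 ≤ θ.s2.lf.B₀)
    (hsel : θ.ppSel = ppSelLiveOfRecord F N θ.ν θ.τ9 (EOfRecord₁₃ F N θ) (wOfRecord₉ F N θ.toStage9Params)) :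
    ∀ k, k < p.K → TLaw₁₃ F N θ p k → SLaw₁₃ F N θ p (k + 1) :=
  laws₁₃_of_liveSel_of_rstep F N θ p (rstep_of_provisos₁₃SepMixed h) hθ hκ hE₀ hB₀ hsel

/-- **The run's `rOperation` leaf reads TRUE at a world bound to the C-binding of record over the Stage-13 view, at the live selector, from `Provisos₁₃SepMixed`.**
[cite: Balaban1988Convergent, p.244; Balaban1989LargeFieldII, Thm 1 p.355 (bookkeeping at the record)] -/
theorem rOperation_leavesP_of_liveSel₁₃_sepMixed (w : WorldP) (hup : w.up p = upOfRecord₅C F N (θ.toStage5₁₃ F N) p) (h : θ.Provisos₁₃SepMixed F N)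
    (hθ : θ.Admissible F N) (hκ : 0 ≤ θ.s2.lf.κ) (hE₀ : 0 ≤ θ.s2.lf.E₀) (hB₀ : 0 ≤ θ.s2.lf.B₀)
    (hsel : θ.ppSel = ppSelLiveOfRecord F N θ.ν θ.τ9 (EOfRecord₁₃ F N θ) (wOfRecord₉ F N θ.toStage9Params)) :
    (leavesP w p).rOperation :=
  rOperation_leavesP_of_liveSel₁₃_of_rstep F N θ p w hup (rstep_of_provisos₁₃SepMixed h) hθ hκ hE₀ hB₀ hsel

/-- **★ AT THE LIVE SELECTOR, `ρ_{k+1} = 𝐓ρ_k` ALMOST EVERYWHERE from `Provisos₁₃SepMixed`**, `k < K`. [cite: Balaban1989LargeFieldI, (0.2)–(0.4) p.176, p.177 (i)–(ii); Balaban1988Convergent, (2.18) p.257, (3.24)–(3.25) p.270] -/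
theorem densOfRecord₁₃_succ_ae_eq_tdens_of_liveSel_sepMixed (h : θ.Provisos₁₃SepMixed F N)
    (hsel : θ.ppSel = ppSelLiveOfRecord F N θ.ν θ.τ9 (EOfRecord₁₃ F N θ) (wOfRecord₉ F N θ.toStage9Params)) (k : ℕ) (hk : k < p.K) :
    densOfRecord₁₃ F N θ p (k + 1) =ᵐ[fieldMeasure (F.P p.K) (k + 1) (SU N)] tdensOfRecord₁₃ F N θ p k :=
  densOfRecord₁₃_succ_ae_eq_tdens_of_liveSel_of_rstep F N θ p (rstep_of_provisos₁₃SepMixed h) hsel k hk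

/-- **★ THEOREM 1 [III] AT THE LIVE SELECTOR FROM (S1ᵀ) AT THE `LiveSeq` SEQUENCES ONLY, from `Provisos₁₃SepMixed`.** [cite: Balaban1988Convergent, Thm 1 p.262; Theorem p.245; p.244; Balaban1989LargeFieldI, (0.3) p.176, p.177 (i)–(ii)] -/
theorem sLaw₁₃_all_of_thmP245LiveSeq_of_liveSel_sepMixed (h : θ.Provisos₁₃SepMixed F N) (hθ : θ.Admissible F N) (hκ : 0 ≤ θ.s2.lf.κ) (hE₀ : 0 ≤ θ.s2.lf.E₀)
    (hB₀ : 0 ≤ θ.s2.lf.B₀) (hsel : θ.ppSel = ppSelLiveOfRecord F N θ.ν θ.τ9 (EOfRecord₁₃ F N θ) (wOfRecord₉ F N θ.toStage9Params))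
    (hT : ∀ k, k < p.K → SLaw₁₃ F N θ p k →
      ∃ (t : SeqOfRecord F θ.ν θ.τ9.M (gOfRecord₁₃ F N θ p) p.K (k + 1) → Sect2.TermValues (F.P p.K) (MatA N) (FluctV N) θ.τ9.M)
      (Ek : SeqOfRecord F θ.ν θ.τ9.M (gOfRecord₁₃ F N θ p) p.K (k + 1) → ℝ), Sect2.UniversalE t ∧
      ∀ s, Sect2.LawsT (sect2TowerOfRecord F N (FluctV N) p.K (settingOfRecord₁₃ F N θ p) (θ.Rz p.K) s (t s)) (settingOfRecord₁₃ F N θ p).lf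
          (settingOfRecord₁₃ F N θ p).βc k ∧
        (LiveSeq F N θ.ν θ.τ9 p (gOfRecord₁₃ F N θ p) (k + 1)
            (slotsTOfRecord F N θ.ν θ.τ9 (EOfRecord₁₃ F N θ) (wOfRecord₉ F N θ.toStage9Params) θ.ppSel p (gOfRecord₁₃ F N θ p) (k + 1)) s →
          (slotsTOfRecord F N θ.ν θ.τ9 (EOfRecord₁₃ F N θ) (wOfRecord₉ F N θ.toStage9Params) θ.ppSel p (gOfRecord₁₃ F N θ p) (k + 1) s = 0 ∨
            ∀ᵐ V ∂(fieldMeasure (F.P p.K) (k + 1) (SU N)), chiSeqOfRecord F N θ.ν θ.τ9.M (gOfRecord₁₃ F N θ p) p.K (k + 1) s V ≠ 0 →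
              slotsTOfRecord F N θ.ν θ.τ9 (EOfRecord₁₃ F N θ) (wOfRecord₉ F N θ.toStage9Params) θ.ppSel p (gOfRecord₁₃ F N θ p) (k + 1) s V
                = sect2Slot F N (FluctV N) p.K (settingOfRecord₁₃ F N θ p) (θ.Rz p.K) (WtOfRecord₁₃ F N θ p) s (t s) (Ek s)
                    (UbgOfRecord₁₃ F N θ p (k + 1) s) V))) :
    ∀ k, k ≤ p.K → SLaw₁₃ F N θ p k :=
  sLaw₁₃_all_of_thmP245LiveSeq_of_liveSel_of_rstep F N θ p (rstep_of_provisos₁₃SepMixed h) hθ hκ hE₀ hB₀ hsel hT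

/-- **THEOREM 1 [III] AT THE LIVE SELECTOR FROM THE FULL (S1ᵀ), from `Provisos₁₃SepMixed`.** [cite: Balaban1988Convergent, Thm 1 p.262; Theorem p.245; p.244] -/
theorem sLaw₁₃_all_of_thmP245_of_liveSel_sepMixed (h : θ.Provisos₁₃SepMixed F N) (hθ : θ.Admissible F N) (hκ : 0 ≤ θ.s2.lf.κ) (hE₀ : 0 ≤ θ.s2.lf.E₀)
    (hB₀ : 0 ≤ θ.s2.lf.B₀) (hsel : θ.ppSel = ppSelLiveOfRecord F N θ.ν θ.τ9 (EOfRecord₁₃ F N θ) (wOfRecord₉ F N θ.toStage9Params))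
    (hT : ∀ k, k < p.K → SLaw₁₃ F N θ p k → TLaw₁₃ F N θ p k) :
    ∀ k, k ≤ p.K → SLaw₁₃ F N θ p k :=
  sLaw₁₃_all_of_thmP245_of_liveSel_of_rstep F N θ p (rstep_of_provisos₁₃SepMixed h) hθ hκ hE₀ hB₀ hsel hT

end Leaf

/-! ## §2  THE DATUM-LEVEL JUNCTION at `datumOfRecord₁₃SepMixed F N θ h` -/

section Junction

variable (θ : Stage13Params F N) (p : B12.RunParams) (w : WorldP) (h : θ.Provisos₁₃SepMixed F N)

/-- **Theorem 1's conclusion `densitiesDescribed` AT A v1.2 STAGE-13 WORLD FROM THE TWO LAW SLOTS** (core unchanged: `densitiesDescribed_iff_core` at `towerOfRecord₁₃SepMixed`).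
[cite: Balaban1988Convergent, Thm 1 p.262; Theorem p.245; p.244] -/
theorem densitiesDescribed_at_record₁₃SepMixed_of_laws (hC : w.C = (datumOfRecord₁₃SepMixed F N θ h).C)
    (hR : ∀ k, k < p.K → TLaw₁₃ F N θ p k → SLaw₁₃ F N θ p (k + 1)) (hT : ∀ k, k < p.K → SLaw₁₃ F N θ p k → TLaw₁₃ F N θ p k) :
    (leavesP w p).densitiesDescribed :=
  (densitiesDescribed_iff_core F N (coreOfRecord₁₃ F N θ) (towerOfRecord₁₃SepMixed F N θ h) w p hC).2 (sLaw₁₃_all_of_laws F N θ p hR hT)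

/-- **`densitiesDescribed` AT A v1.2 STAGE-13 WORLD AT THE LIVE SELECTOR FROM (S1ᵀ) ALONE** (the 𝐑-slot supplied). [cite: Balaban1988Convergent, Thm 1 p.262; Theorem p.245; p.244] -/
theorem densitiesDescribed_at_record₁₃SepMixed_of_liveSel (hC : w.C = (datumOfRecord₁₃SepMixed F N θ h).C) (hθ : θ.Admissible F N) (hκ : 0 ≤ θ.s2.lf.κ)
    (hE₀ : 0 ≤ θ.s2.lf.E₀) (hB₀ : 0 ≤ θ.s2.lf.B₀)
    (hsel : θ.ppSel = ppSelLiveOfRecord F N θ.ν θ.τ9 (EOfRecord₁₃ F N θ) (wOfRecord₉ F N θ.toStage9Params))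
    (hT : ∀ k, k < p.K → SLaw₁₃ F N θ p k → TLaw₁₃ F N θ p k) : (leavesP w p).densitiesDescribed :=
  densitiesDescribed_at_record₁₃SepMixed_of_laws F N θ p w h hC (laws₁₃_of_liveSel_sepMixed F N θ p h hθ hκ hE₀ hB₀ hsel) hT

/-- **N11 · `Dag.B14_main (leavesP w P)` AT A v1.2 STAGE-13 WORLD, 𝐑 READ THROUGH THE LEAF, ONE DISPLAYED SLOT (S1ᵀ)** (n11-a's `b14_main_at_datumOfTower_of_propTower` at the
Stage-13 core and `towerOfRecord₁₃SepMixed`; START `sLaw₁₃_zero`). [cite: Balaban1988Convergent, Thm 1 p.262; Theorem p.245; p.244] -/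
theorem b14_main_at_record₁₃SepMixed_of_rOpLeaf (hC : w.C = (datumOfRecord₁₃SepMixed F N θ h).C)
    (hV : (leavesP w p).rOperation → ROpLeaf (VOfRecord₁₃ F N θ p))
    (hT : (leavesP w p).b7 → (leavesP w p).b8 → (leavesP w p).b9 → (leavesP w p).b10 → (leavesP w p).b11 →
      (leavesP w p).smallCouplings → (leavesP w p).smallFieldInductive → (leavesP w p).flowControl →
        ∀ k, k < p.K → SLaw₁₃ F N θ p k → TLaw₁₃ F N θ p k) :
    Dag.B14_main (leavesP w p) :=
  b14_main_at_datumOfTower_of_propTower F N (coreOfRecord₁₃ F N θ) (towerOfRecord₁₃SepMixed F N θ h) w p hC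
    (SLaw₁₃ F N θ p) (TLaw₁₃ F N θ p) (fun _ _ hS => hS) (fun _ => sLaw₁₃_zero F N θ p) hT
    (fun hrop => (rOpLeaf_VOfRecord₁₃_iff F N θ p).1 (hV hrop))

/-- **N11 · `Dag.B14_main (leavesP w P)` AT A v1.2 STAGE-13 WORLD AT THE LIVE SELECTOR — ONE DISPLAYED SLOT (S1ᵀ), NO 𝐑-READING HYPOTHESIS.**
[cite: Balaban1988Convergent, Thm 1 p.262; Theorem p.245; p.244; (2.6) p.255] -/
theorem b14_main_at_record₁₃SepMixed_of_liveSel (hC : w.C = (datumOfRecord₁₃SepMixed F N θ h).C) (hθ : θ.Admissible F N) (hκ : 0 ≤ θ.s2.lf.κ)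
    (hE₀ : 0 ≤ θ.s2.lf.E₀) (hB₀ : 0 ≤ θ.s2.lf.B₀)
    (hsel : θ.ppSel = ppSelLiveOfRecord F N θ.ν θ.τ9 (EOfRecord₁₃ F N θ) (wOfRecord₉ F N θ.toStage9Params))
    (hT : (leavesP w p).b7 → (leavesP w p).b8 → (leavesP w p).b9 → (leavesP w p).b10 → (leavesP w p).b11 →
      (leavesP w p).smallCouplings → (leavesP w p).smallFieldInductive → (leavesP w p).flowControl →
        ∀ k, k < p.K → SLaw₁₃ F N θ p k → TLaw₁₃ F N θ p k) :
    Dag.B14_main (leavesP w p) :=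
  b14_main_at_record₁₃SepMixed_of_rOpLeaf F N θ p w h hC (fun _ => rOpLeaf_VOfRecord₁₃_of_liveSel_sepMixed F N θ p h hθ hκ hE₀ hB₀ hsel) hT

/-- **N11 IN THE BINDER SHAPE OF THE rev-18 K1-class stub** (a world with `IsRecordOfRecord₁₃CSepMixed F N (datumOfRecord₁₃SepMixed F N θ h) w` at an EXPLICIT `(θ, h)` carrying the
selector clause): the N11 conjunct at every run from (S1ᵀ) alone (+ signs). [cite: Balaban1988Convergent, Thm 1 p.262; Theorem p.245; p.244 (bookkeeping at the record)] -/
theorem b14_main_of_isRecordOfRecord₁₃CSepMixed_datum_of_liveSel (hrec : IsRecordOfRecord₁₃CSepMixed F N (datumOfRecord₁₃SepMixed F N θ h) w)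
    (hθ : θ.Admissible F N) (hκ : 0 ≤ θ.s2.lf.κ) (hE₀ : 0 ≤ θ.s2.lf.E₀) (hB₀ : 0 ≤ θ.s2.lf.B₀)
    (hsel : θ.ppSel = ppSelLiveOfRecord F N θ.ν θ.τ9 (EOfRecord₁₃ F N θ) (wOfRecord₉ F N θ.toStage9Params))
    (hT : ∀ P : B12.RunParams, (leavesP w P).b7 → (leavesP w P).b8 → (leavesP w P).b9 → (leavesP w P).b10 → (leavesP w P).b11 →
      (leavesP w P).smallCouplings → (leavesP w P).smallFieldInductive → (leavesP w P).flowControl →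
        ∀ k, k < P.K → SLaw₁₃ F N θ P k → TLaw₁₃ F N θ P k) (P : B12.RunParams) :
    Dag.B14_main (leavesP w P) :=
  b14_main_at_record₁₃SepMixed_of_liveSel F N θ P w h (construction_eq_of_isRecordOfRecord₁₃CSepMixed hrec) hθ hκ hE₀ hB₀ hsel (hT P)

/-- **★ THE (B)-FACE's FIRST CONJUNCT `B16.Thm1Printed (datumOfRecord₁₃SepMixed F N θ h).C` AT THE LIVE SELECTOR FROM THE FULL (S1ᵀ) along the windowed runs** (node00-def-T's
`thm1Printed_datumOfRecord₁₃SepMixed_of_tLaw_rOpLeaf` with the leaf SUPPLIED). [cite: Balaban1989LargeFieldII, Thm 1 p.355; Balaban1988Convergent, Thm 1 p.262; Theorem p.245; p.244] -/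
theorem thm1Printed_datumOfRecord₁₃SepMixed_of_laws_of_liveSel (hθ : θ.Admissible F N) (hκ : 0 ≤ θ.s2.lf.κ) (hE₀ : 0 ≤ θ.s2.lf.E₀) (hB₀ : 0 ≤ θ.s2.lf.B₀)
    {γ : ℝ} (hγ : 0 < γ) (hsel : θ.ppSel = ppSelLiveOfRecord F N θ.ν θ.τ9 (EOfRecord₁₃ F N θ) (wOfRecord₉ F N θ.toStage9Params))
    (hT : ∀ P : B12.RunParams, ((datumOfRecord₁₃SepMixed F N θ h).C P).flow.InInterval γ P.K →
      ∀ k, k < P.K → SLaw₁₃ F N θ P k → TLaw₁₃ F N θ P k) :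
    B16.Thm1Printed (datumOfRecord₁₃SepMixed F N θ h).C :=
  thm1Printed_datumOfRecord₁₃SepMixed_of_tLaw_rOpLeaf F N θ h hγ hT (fun P _ => rOpLeaf_VOfRecord₁₃_of_liveSel_sepMixed F N θ P h hθ hκ hE₀ hB₀ hsel)

/-- **`B16.InductionStep` AT THE v1.2 STAGE-13 DATUM AT THE LIVE SELECTOR FROM (S1ᵀ) AT THE `LiveSeq` SEQUENCES ONLY** (K0a's currency; faces `sect2Form_stage13SepMixed_iff`).
[cite: Balaban1989LargeFieldII, Thm 1 p.355 and pp.390–391; Balaban1988Convergent, Thm 1 p.262; Theorem p.245; p.244] -/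
theorem inductionStep_datumOfRecord₁₃SepMixed_of_tLawLiveSeq_of_liveSel (hθ : θ.Admissible F N) (hκ : 0 ≤ θ.s2.lf.κ) (hE₀ : 0 ≤ θ.s2.lf.E₀)
    (hB₀ : 0 ≤ θ.s2.lf.B₀) (γ : ℝ) (hsel : θ.ppSel = ppSelLiveOfRecord F N θ.ν θ.τ9 (EOfRecord₁₃ F N θ) (wOfRecord₉ F N θ.toStage9Params))
    (hT : ∀ P : B12.RunParams, ((datumOfRecord₁₃SepMixed F N θ h).C P).flow.InInterval γ P.K → ∀ k, k < P.K → SLaw₁₃ F N θ P k →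
      ∃ (t : SeqOfRecord F θ.ν θ.τ9.M (gOfRecord₁₃ F N θ P) P.K (k + 1) → Sect2.TermValues (F.P P.K) (MatA N) (FluctV N) θ.τ9.M)
      (Ek : SeqOfRecord F θ.ν θ.τ9.M (gOfRecord₁₃ F N θ P) P.K (k + 1) → ℝ), Sect2.UniversalE t ∧
      ∀ s, Sect2.LawsT (sect2TowerOfRecord F N (FluctV N) P.K (settingOfRecord₁₃ F N θ P) (θ.Rz P.K) s (t s)) (settingOfRecord₁₃ F N θ P).lf
          (settingOfRecord₁₃ F N θ P).βc k ∧
        (LiveSeq F N θ.ν θ.τ9 P (gOfRecord₁₃ F N θ P) (k + 1)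
            (slotsTOfRecord F N θ.ν θ.τ9 (EOfRecord₁₃ F N θ) (wOfRecord₉ F N θ.toStage9Params) θ.ppSel P (gOfRecord₁₃ F N θ P) (k + 1)) s →
          (slotsTOfRecord F N θ.ν θ.τ9 (EOfRecord₁₃ F N θ) (wOfRecord₉ F N θ.toStage9Params) θ.ppSel P (gOfRecord₁₃ F N θ P) (k + 1) s = 0 ∨
            ∀ᵐ V ∂(fieldMeasure (F.P P.K) (k + 1) (SU N)), chiSeqOfRecord F N θ.ν θ.τ9.M (gOfRecord₁₃ F N θ P) P.K (k + 1) s V ≠ 0 →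
              slotsTOfRecord F N θ.ν θ.τ9 (EOfRecord₁₃ F N θ) (wOfRecord₉ F N θ.toStage9Params) θ.ppSel P (gOfRecord₁₃ F N θ P) (k + 1) s V
                = sect2Slot F N (FluctV N) P.K (settingOfRecord₁₃ F N θ P) (θ.Rz P.K) (WtOfRecord₁₃ F N θ P) s (t s) (Ek s)
                    (UbgOfRecord₁₃ F N θ P (k + 1) s) V))) :
    B16.InductionStep (datumOfRecord₁₃SepMixed F N θ h).C γ := by
  intro P hP k hk hS
  have hS' : SLaw₁₃ F N θ P k := (sLaw₁₃_iff F N θ P k).mpr ((sect2Form_stage13SepMixed_iff F N θ h P k).mp hS)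
  exact (sect2Form_stage13SepMixed_iff F N θ h P (k + 1)).mpr ((sLaw₁₃_iff F N θ P (k + 1)).mp
    (sLaw₁₃_succ_of_tLawLiveSeq_of_liveSel_of_rstep F N θ P (rstep_of_provisos₁₃SepMixed h) hθ hκ hE₀ hB₀ hsel k hk (hT P hP k hk hS')))

/-- **★ THE (B)-FACE's FIRST CONJUNCT AT THE v1.2 DATUM AT THE LIVE SELECTOR FROM (S1ᵀ) AT THE `LiveSeq` SEQUENCES ONLY** (`0 < γ`; base `inductionBase_datumOfRecord₁₃SepMixed`).
[cite: Balaban1989LargeFieldII, Thm 1 p.355 + p.391; Balaban1988Convergent, Thm 1 p.262; Theorem p.245] -/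
theorem thm1Printed_datumOfRecord₁₃SepMixed_of_lawsLive_of_liveSel (hθ : θ.Admissible F N) (hκ : 0 ≤ θ.s2.lf.κ) (hE₀ : 0 ≤ θ.s2.lf.E₀)
    (hB₀ : 0 ≤ θ.s2.lf.B₀) {γ : ℝ} (hγ : 0 < γ) (hsel : θ.ppSel = ppSelLiveOfRecord F N θ.ν θ.τ9 (EOfRecord₁₃ F N θ) (wOfRecord₉ F N θ.toStage9Params))
    (hT : ∀ P : B12.RunParams, ((datumOfRecord₁₃SepMixed F N θ h).C P).flow.InInterval γ P.K → ∀ k, k < P.K → SLaw₁₃ F N θ P k →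
      ∃ (t : SeqOfRecord F θ.ν θ.τ9.M (gOfRecord₁₃ F N θ P) P.K (k + 1) → Sect2.TermValues (F.P P.K) (MatA N) (FluctV N) θ.τ9.M)
      (Ek : SeqOfRecord F θ.ν θ.τ9.M (gOfRecord₁₃ F N θ P) P.K (k + 1) → ℝ), Sect2.UniversalE t ∧
      ∀ s, Sect2.LawsT (sect2TowerOfRecord F N (FluctV N) P.K (settingOfRecord₁₃ F N θ P) (θ.Rz P.K) s (t s)) (settingOfRecord₁₃ F N θ P).lf
          (settingOfRecord₁₃ F N θ P).βc k ∧
        (LiveSeq F N θ.ν θ.τ9 P (gOfRecord₁₃ F N θ P) (k + 1)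
            (slotsTOfRecord F N θ.ν θ.τ9 (EOfRecord₁₃ F N θ) (wOfRecord₉ F N θ.toStage9Params) θ.ppSel P (gOfRecord₁₃ F N θ P) (k + 1)) s →
          (slotsTOfRecord F N θ.ν θ.τ9 (EOfRecord₁₃ F N θ) (wOfRecord₉ F N θ.toStage9Params) θ.ppSel P (gOfRecord₁₃ F N θ P) (k + 1) s = 0 ∨
            ∀ᵐ V ∂(fieldMeasure (F.P P.K) (k + 1) (SU N)), chiSeqOfRecord F N θ.ν θ.τ9.M (gOfRecord₁₃ F N θ P) P.K (k + 1) s V ≠ 0 →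
              slotsTOfRecord F N θ.ν θ.τ9 (EOfRecord₁₃ F N θ) (wOfRecord₉ F N θ.toStage9Params) θ.ppSel P (gOfRecord₁₃ F N θ P) (k + 1) s V
                = sect2Slot F N (FluctV N) P.K (settingOfRecord₁₃ F N θ P) (θ.Rz P.K) (WtOfRecord₁₃ F N θ P) s (t s) (Ek s)
                    (UbgOfRecord₁₃ F N θ P (k + 1) s) V))) :
    B16.Thm1Printed (datumOfRecord₁₃SepMixed F N θ h).C :=
  B16.thm1_of_steps _ γ hγ (inductionBase_datumOfRecord₁₃SepMixed F N θ h γ)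
    (inductionStep_datumOfRecord₁₃SepMixed_of_tLawLiveSeq_of_liveSel F N θ h hθ hκ hE₀ hB₀ γ hsel hT)

end Junction

/-! ## §3  AT K0a's LIVE RE-PIN `θ.liveRepin₁₃` (the selector clause is `rfl`) with the v1.2 datum -/

section Repin

variable (θ : Stage13Params F N) (p : B12.RunParams) (w : WorldP)

/-- **The (R₁₃) slot in law form at the re-pin from `Provisos₁₃SepMixed` there.** [cite: Balaban1988Convergent, p.244 (bookkeeping); Balaban1989LargeFieldII, Thm 1 p.355 (not exercised)] -/
theorem laws₁₃_liveRepin₁₃_sepMixed (h : (θ.liveRepin₁₃ F N).Provisos₁₃SepMixed F N) (hθ : θ.Admissible F N) (hκ : 0 ≤ θ.s2.lf.κ) (hE₀ : 0 ≤ θ.s2.lf.E₀)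
    (hB₀ : 0 ≤ θ.s2.lf.B₀) :
    ∀ k, k < p.K → TLaw₁₃ F N (θ.liveRepin₁₃ F N) p k → SLaw₁₃ F N (θ.liveRepin₁₃ F N) p (k + 1) :=
  laws₁₃_of_liveSel_sepMixed F N (θ.liveRepin₁₃ F N) p h hθ.liveRepin₁₃ hκ hE₀ hB₀ (liveRepin₁₃_liveSel F N θ)

variable (h : (θ.liveRepin₁₃ F N).Provisos₁₃SepMixed F N)

/-- **N11 · `Dag.B14_main` AT A WORLD BOUND TO THE RE-PIN's v1.2 DATUM — ONE DISPLAYED SLOT (S1ᵀ).** [cite: Balaban1988Convergent, Thm 1 p.262; Theorem p.245; p.244; (2.6) p.255] -/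
theorem b14_main_at_record₁₃SepMixed_liveRepin₁₃ (hC : w.C = (datumOfRecord₁₃SepMixed F N (θ.liveRepin₁₃ F N) h).C) (hθ : θ.Admissible F N) (hκ : 0 ≤ θ.s2.lf.κ)
    (hE₀ : 0 ≤ θ.s2.lf.E₀) (hB₀ : 0 ≤ θ.s2.lf.B₀)
    (hT : (leavesP w p).b7 → (leavesP w p).b8 → (leavesP w p).b9 → (leavesP w p).b10 → (leavesP w p).b11 →
      (leavesP w p).smallCouplings → (leavesP w p).smallFieldInductive → (leavesP w p).flowControl →
        ∀ k, k < p.K → SLaw₁₃ F N (θ.liveRepin₁₃ F N) p k → TLaw₁₃ F N (θ.liveRepin₁₃ F N) p k) :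
    Dag.B14_main (leavesP w p) :=
  b14_main_at_record₁₃SepMixed_of_liveSel F N (θ.liveRepin₁₃ F N) p w h hC hθ.liveRepin₁₃ hκ hE₀ hB₀ (liveRepin₁₃_liveSel F N θ) hT

/-- **★ THE (B)-FACE's FIRST CONJUNCT AT THE RE-PIN's v1.2 DATUM FROM THE FULL (S1ᵀ) along the windowed runs.** [cite: Balaban1989LargeFieldII, Thm 1 p.355; Balaban1988Convergent, Thm 1 p.262; Theorem p.245; p.244] -/
theorem thm1Printed_datumOfRecord₁₃SepMixed_liveRepin₁₃_of_laws (hθ : θ.Admissible F N) (hκ : 0 ≤ θ.s2.lf.κ) (hE₀ : 0 ≤ θ.s2.lf.E₀) (hB₀ : 0 ≤ θ.s2.lf.B₀)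
    {γ : ℝ} (hγ : 0 < γ)
    (hT : ∀ P : B12.RunParams, ((datumOfRecord₁₃SepMixed F N (θ.liveRepin₁₃ F N) h).C P).flow.InInterval γ P.K →
      ∀ k, k < P.K → SLaw₁₃ F N (θ.liveRepin₁₃ F N) P k → TLaw₁₃ F N (θ.liveRepin₁₃ F N) P k) :
    B16.Thm1Printed (datumOfRecord₁₃SepMixed F N (θ.liveRepin₁₃ F N) h).C :=
  thm1Printed_datumOfRecord₁₃SepMixed_of_laws_of_liveSel F N (θ.liveRepin₁₃ F N) h hθ.liveRepin₁₃ hκ hE₀ hB₀ hγ (liveRepin₁₃_liveSel F N θ) hT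

end Repin

/-! ## §4  AT THE WITNESSES CARRYING K0b's RESIDUALS with the v1.2 datum binder (admissibility and signs by the numerals of record) -/

section OfRecord

variable (p : B12.RunParams) (w : WorldP) (h : (theta13LiveOfRecord F N).Provisos₁₃SepMixed F N)

/-- **N11 · `Dag.B14_main` AT A WORLD BOUND TO THE v1.2 DATUM OF THE WITNESS OF RECORD — ONE DISPLAYED SLOT (S1ᵀ), nothing else** (the 𝐑-slot is the closed theorem
`rOpLeaf_VOfRecord₁₃_theta13LiveOfRecord`). [cite: Balaban1988Convergent, Thm 1 p.262; Theorem p.245; p.244; (2.6) p.255] -/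
theorem b14_main_at_record₁₃SepMixed_theta13LiveOfRecord (hC : w.C = (datumOfRecord₁₃SepMixed F N (theta13LiveOfRecord F N) h).C)
    (hT : (leavesP w p).b7 → (leavesP w p).b8 → (leavesP w p).b9 → (leavesP w p).b10 → (leavesP w p).b11 →
      (leavesP w p).smallCouplings → (leavesP w p).smallFieldInductive → (leavesP w p).flowControl →
        ∀ k, k < p.K → SLaw₁₃ F N (theta13LiveOfRecord F N) p k → TLaw₁₃ F N (theta13LiveOfRecord F N) p k) :
    Dag.B14_main (leavesP w p) :=
  b14_main_at_record₁₃SepMixed_of_rOpLeaf F N (theta13LiveOfRecord F N) p w h hC (fun _ => rOpLeaf_VOfRecord₁₃_theta13LiveOfRecord F N p) hT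

/-- **★ THE (B)-FACE's FIRST CONJUNCT AT THE v1.2 DATUM OF THE WITNESS OF RECORD FROM THE FULL (S1ᵀ) along the windowed runs** (`0 < γ`; the 𝐑-slot closed).
[cite: Balaban1989LargeFieldII, Thm 1 p.355; Balaban1988Convergent, Thm 1 p.262; Theorem p.245; p.244] -/
theorem thm1Printed_datumOfRecord₁₃SepMixed_theta13LiveOfRecord_of_laws {γ : ℝ} (hγ : 0 < γ)
    (hT : ∀ P : B12.RunParams, ((datumOfRecord₁₃SepMixed F N (theta13LiveOfRecord F N) h).C P).flow.InInterval γ P.K →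
      ∀ k, k < P.K → SLaw₁₃ F N (theta13LiveOfRecord F N) P k → TLaw₁₃ F N (theta13LiveOfRecord F N) P k) :
    B16.Thm1Printed (datumOfRecord₁₃SepMixed F N (theta13LiveOfRecord F N) h).C :=
  thm1Printed_datumOfRecord₁₃SepMixed_of_tLaw_rOpLeaf F N (theta13LiveOfRecord F N) h hγ hT (fun P _ => rOpLeaf_VOfRecord₁₃_theta13LiveOfRecord F N P)

/-- **`densitiesDescribed` AT A WORLD BOUND TO THE v1.2 DATUM OF THE WITNESS OF RECORD FROM (S1ᵀ) ALONE.** [cite: Balaban1988Convergent, Thm 1 p.262; Theorem p.245; p.244] -/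
theorem densitiesDescribed_at_record₁₃SepMixed_theta13LiveOfRecord (hC : w.C = (datumOfRecord₁₃SepMixed F N (theta13LiveOfRecord F N) h).C)
    (hT : ∀ k, k < p.K → SLaw₁₃ F N (theta13LiveOfRecord F N) p k → TLaw₁₃ F N (theta13LiveOfRecord F N) p k) :
    (leavesP w p).densitiesDescribed :=
  densitiesDescribed_at_record₁₃SepMixed_of_laws F N (theta13LiveOfRecord F N) p w h hC (laws₁₃_theta13LiveOfRecord F N p) hT

end OfRecord

section Thm1Witness

variable {ε₀ ε₂₉ B₃ a₀ a₁ : ℝ} (p : B12.RunParams) (w : WorldP) (h : (theta13OfThm1 F N ε₀ ε₂₉ B₃ a₀ a₁).Provisos₁₃SepMixed F N)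

/-- **N11 · `Dag.B14_main` AT A WORLD BOUND TO THE v1.2 DATUM OF K0a's [15]-KEYED WITNESS `θ₁₅` — (S1ᵀ) + the five signs.** [cite: Balaban1988Convergent, Thm 1 p.262; Theorem p.245; p.244; (2.6) p.255] -/
theorem b14_main_at_record₁₃SepMixed_theta13OfThm1 (hε : 0 < ε₀) (hε' : 0 < ε₂₉) (hB : 0 ≤ B₃) (ha₀ : 0 < a₀) (ha₁ : 0 < a₁)
    (hC : w.C = (datumOfRecord₁₃SepMixed F N (theta13OfThm1 F N ε₀ ε₂₉ B₃ a₀ a₁) h).C)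
    (hT : (leavesP w p).b7 → (leavesP w p).b8 → (leavesP w p).b9 → (leavesP w p).b10 → (leavesP w p).b11 →
      (leavesP w p).smallCouplings → (leavesP w p).smallFieldInductive → (leavesP w p).flowControl →
        ∀ k, k < p.K → SLaw₁₃ F N (theta13OfThm1 F N ε₀ ε₂₉ B₃ a₀ a₁) p k → TLaw₁₃ F N (theta13OfThm1 F N ε₀ ε₂₉ B₃ a₀ a₁) p k) :
    Dag.B14_main (leavesP w p) :=
  b14_main_at_record₁₃SepMixed_of_rOpLeaf F N _ p w h hC (fun _ => rOpLeaf_VOfRecord₁₃_theta13OfThm1 F N p hε hε' hB ha₀ ha₁) hT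

/-- **★ THE (B)-FACE's FIRST CONJUNCT AT THE v1.2 DATUM OF `θ₁₅` FROM THE FULL (S1ᵀ)** (`0 < γ`; five signs). [cite: Balaban1989LargeFieldII, Thm 1 p.355; Balaban1988Convergent, Thm 1 p.262; Theorem p.245; p.244] -/
theorem thm1Printed_datumOfRecord₁₃SepMixed_theta13OfThm1_of_laws (hε : 0 < ε₀) (hε' : 0 < ε₂₉) (hB : 0 ≤ B₃) (ha₀ : 0 < a₀) (ha₁ : 0 < a₁)
    {γ : ℝ} (hγ : 0 < γ)
    (hT : ∀ P : B12.RunParams, ((datumOfRecord₁₃SepMixed F N (theta13OfThm1 F N ε₀ ε₂₉ B₃ a₀ a₁) h).C P).flow.InInterval γ P.K →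
      ∀ k, k < P.K → SLaw₁₃ F N (theta13OfThm1 F N ε₀ ε₂₉ B₃ a₀ a₁) P k → TLaw₁₃ F N (theta13OfThm1 F N ε₀ ε₂₉ B₃ a₀ a₁) P k) :
    B16.Thm1Printed (datumOfRecord₁₃SepMixed F N (theta13OfThm1 F N ε₀ ε₂₉ B₃ a₀ a₁) h).C :=
  thm1Printed_datumOfRecord₁₃SepMixed_of_tLaw_rOpLeaf F N _ h hγ hT (fun P _ => rOpLeaf_VOfRecord₁₃_theta13OfThm1 F N P hε hε' hB ha₀ ha₁)

end Thm1Witness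

section Thm1CWitness

variable {ε₀ ε₂₉ B₃ a₀ a₁ : ℝ} (p : B12.RunParams) (w : WorldP) (h : (theta13OfThm1C F N ε₀ ε₂₉ B₃ a₀ a₁).Provisos₁₃SepMixed F N)

/-- **N11 · `Dag.B14_main` AT A WORLD BOUND TO THE v1.2 DATUM OF K0a's `L`-KEYED WITNESS `θ₁₅ᶜ` — (S1ᵀ) + the five signs.** [cite: Balaban1988Convergent, Thm 1 p.262; Theorem p.245; p.244; (2.6) p.255] -/
theorem b14_main_at_record₁₃SepMixed_theta13OfThm1C (hε : 0 < ε₀) (hε' : 0 < ε₂₉) (hB : 0 ≤ B₃) (ha₀ : 0 < a₀) (ha₁ : 0 < a₁)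
    (hC : w.C = (datumOfRecord₁₃SepMixed F N (theta13OfThm1C F N ε₀ ε₂₉ B₃ a₀ a₁) h).C)
    (hT : (leavesP w p).b7 → (leavesP w p).b8 → (leavesP w p).b9 → (leavesP w p).b10 → (leavesP w p).b11 →
      (leavesP w p).smallCouplings → (leavesP w p).smallFieldInductive → (leavesP w p).flowControl →
        ∀ k, k < p.K → SLaw₁₃ F N (theta13OfThm1C F N ε₀ ε₂₉ B₃ a₀ a₁) p k → TLaw₁₃ F N (theta13OfThm1C F N ε₀ ε₂₉ B₃ a₀ a₁) p k) :
    Dag.B14_main (leavesP w p) :=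
  b14_main_at_record₁₃SepMixed_of_rOpLeaf F N _ p w h hC (fun _ => rOpLeaf_VOfRecord₁₃_theta13OfThm1C F N p hε hε' hB ha₀ ha₁) hT

/-- **★ THE (B)-FACE's FIRST CONJUNCT AT THE v1.2 DATUM OF `θ₁₅ᶜ` FROM THE FULL (S1ᵀ)** (`0 < γ`; five signs). [cite: Balaban1989LargeFieldII, Thm 1 p.355; Balaban1988Convergent, Thm 1 p.262; Theorem p.245; p.244] -/
theorem thm1Printed_datumOfRecord₁₃SepMixed_theta13OfThm1C_of_laws (hε : 0 < ε₀) (hε' : 0 < ε₂₉) (hB : 0 ≤ B₃) (ha₀ : 0 < a₀) (ha₁ : 0 < a₁)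
    {γ : ℝ} (hγ : 0 < γ)
    (hT : ∀ P : B12.RunParams, ((datumOfRecord₁₃SepMixed F N (theta13OfThm1C F N ε₀ ε₂₉ B₃ a₀ a₁) h).C P).flow.InInterval γ P.K →
      ∀ k, k < P.K → SLaw₁₃ F N (theta13OfThm1C F N ε₀ ε₂₉ B₃ a₀ a₁) P k → TLaw₁₃ F N (theta13OfThm1C F N ε₀ ε₂₉ B₃ a₀ a₁) P k) :
    B16.Thm1Printed (datumOfRecord₁₃SepMixed F N (theta13OfThm1C F N ε₀ ε₂₉ B₃ a₀ a₁) h).C :=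
  thm1Printed_datumOfRecord₁₃SepMixed_of_tLaw_rOpLeaf F N _ h hγ hT (fun P _ => rOpLeaf_VOfRecord₁₃_theta13OfThm1C F N P hε hε' hB ha₀ ha₁)

end Thm1CWitness

section Numerics

variable {n : Stage12Numerics} {ε₂₉ : ℝ} (p : B12.RunParams) (w : WorldP)
  (h : (theta13LiveOfNumerics F N n ε₂₉ (zeta316OfRecord F N n.ν n.τ9.M n.A₁) (RzOfRecord F N) (ZtOfRecord F N)).Provisos₁₃SepMixed F N)

/-- **N11 · `Dag.B14_main` AT A WORLD BOUND TO THE v1.2 DATUM OF THE ALL-NUMERICS WITNESS `θ₁₃(n, ε₂₉)`** (`n.Pos`, `0 < ε₂₉`, the three signs of `n`; (S1ᵀ)).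
[cite: Balaban1988Convergent, Thm 1 p.262; Theorem p.245; p.244; (2.6) p.255] -/
theorem b14_main_at_record₁₃SepMixed_theta13LiveOfNumerics (hn : n.Pos) (hε' : 0 < ε₂₉) (hκ : 0 ≤ n.s2.lf.κ) (hE₀ : 0 ≤ n.s2.lf.E₀) (hB₀ : 0 ≤ n.s2.lf.B₀)
    (hC : w.C = (datumOfRecord₁₃SepMixed F N
      (theta13LiveOfNumerics F N n ε₂₉ (zeta316OfRecord F N n.ν n.τ9.M n.A₁) (RzOfRecord F N) (ZtOfRecord F N)) h).C)
    (hT : (leavesP w p).b7 → (leavesP w p).b8 → (leavesP w p).b9 → (leavesP w p).b10 → (leavesP w p).b11 →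
      (leavesP w p).smallCouplings → (leavesP w p).smallFieldInductive → (leavesP w p).flowControl →
        ∀ k, k < p.K → SLaw₁₃ F N (theta13LiveOfNumerics F N n ε₂₉ (zeta316OfRecord F N n.ν n.τ9.M n.A₁) (RzOfRecord F N) (ZtOfRecord F N)) p k →
          TLaw₁₃ F N (theta13LiveOfNumerics F N n ε₂₉ (zeta316OfRecord F N n.ν n.τ9.M n.A₁) (RzOfRecord F N) (ZtOfRecord F N)) p k) :
    Dag.B14_main (leavesP w p) :=
  b14_main_at_record₁₃SepMixed_of_rOpLeaf F N _ p w h hC (fun _ => rOpLeaf_VOfRecord₁₃_theta13LiveOfNumerics F N p hn hε' hκ hE₀ hB₀) hT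

/-- **★ THE (B)-FACE's FIRST CONJUNCT AT THE v1.2 DATUM OF `θ₁₃(n, ε₂₉)` FROM THE FULL (S1ᵀ)** (`0 < γ`; `n.Pos`, `0 < ε₂₉`, signs).
[cite: Balaban1989LargeFieldII, Thm 1 p.355; Balaban1988Convergent, Thm 1 p.262; Theorem p.245; p.244] -/
theorem thm1Printed_datumOfRecord₁₃SepMixed_theta13LiveOfNumerics_of_laws (hn : n.Pos) (hε' : 0 < ε₂₉) (hκ : 0 ≤ n.s2.lf.κ) (hE₀ : 0 ≤ n.s2.lf.E₀)
    (hB₀ : 0 ≤ n.s2.lf.B₀) {γ : ℝ} (hγ : 0 < γ)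
    (hT : ∀ P : B12.RunParams, ((datumOfRecord₁₃SepMixed F N
        (theta13LiveOfNumerics F N n ε₂₉ (zeta316OfRecord F N n.ν n.τ9.M n.A₁) (RzOfRecord F N) (ZtOfRecord F N)) h).C P).flow.InInterval γ P.K →
      ∀ k, k < P.K → SLaw₁₃ F N (theta13LiveOfNumerics F N n ε₂₉ (zeta316OfRecord F N n.ν n.τ9.M n.A₁) (RzOfRecord F N) (ZtOfRecord F N)) P k →
        TLaw₁₃ F N (theta13LiveOfNumerics F N n ε₂₉ (zeta316OfRecord F N n.ν n.τ9.M n.A₁) (RzOfRecord F N) (ZtOfRecord F N)) P k) :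
    B16.Thm1Printed (datumOfRecord₁₃SepMixed F N
      (theta13LiveOfNumerics F N n ε₂₉ (zeta316OfRecord F N n.ν n.τ9.M n.A₁) (RzOfRecord F N) (ZtOfRecord F N)) h).C :=
  thm1Printed_datumOfRecord₁₃SepMixed_of_tLaw_rOpLeaf F N _ h hγ hT (fun P _ => rOpLeaf_VOfRecord₁₃_theta13LiveOfNumerics F N P hn hε' hκ hE₀ hB₀)

end Numerics

/-! ## §5  THE DIRECTOR's ROW IN [III]'s OWN NAMES at the v1.2 datum: `B16.Thm1Printed (datumOfRecord₁₃SepMixed θ h).C` from `B14.ThmP245PrintedI` («the Theorem of p. 245»)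
and `B14.RAssumedP244` ∕ the supplied leaf (`…B14NodeKnitRecord13R`'s dictionaries `thmP245PrintedI_at_record₁₃_iff_laws`, `rOpLeaf₁₃_iff_rAssumedP244` are `h`-free) -/

section Thm1PrintedNamed

variable (θ : Stage13Params F N) (h : θ.Provisos₁₃SepMixed F N)

/-- **`B16.Thm1Printed (datumOfRecord₁₃SepMixed F N θ h).C` FROM THE THEOREM OF p. 245 AND THE p. 244 ASSUMPTION AT THE OBJECTS OF RECORD**, law currency, `T`-free.
[cite: Balaban1988Convergent, Thm 1 p.262; Theorem p.245; p.244; Balaban1989LargeFieldII, Thm 1 p.355 + p.391] -/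
theorem thm1Printed_datumOfRecord₁₃SepMixed_of_laws_rAssumedP244 {γ : ℝ} (hγ : 0 < γ)
    (hT : ∀ P : B12.RunParams, ((datumOfRecord₁₃SepMixed F N θ h).C P).flow.InInterval γ P.K →
      ∀ k, k < P.K → SLaw₁₃ F N θ P k → TLaw₁₃ F N θ P k)
    (hR : ∀ P : B12.RunParams, ((datumOfRecord₁₃SepMixed F N θ h).C P).flow.InInterval γ P.K →
      B14.RAssumedP244 (VOfRecord₁₃ F N θ P).R (VOfRecord₁₃ F N θ P).Scorr (VOfRecord₁₃ F N θ P).S P.K) :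
    B16.Thm1Printed (datumOfRecord₁₃SepMixed F N θ h).C :=
  thm1Printed_datumOfRecord₁₃SepMixed_of_tLaw_rOpLeaf F N θ h hγ hT
    (fun P hP => (B14NodeKnitRecord13R.rOpLeaf₁₃_iff_rAssumedP244 F N θ P).2 (hR P hP))

/-- **`B16.Thm1Printed` AT THE v1.2 DATUM FROM [III]'s TWO SENTENCES IN [III]'s OWN NAMES** — `B14.ThmP245PrintedI` (any `T`-family agreeing with the tower on the
trajectory of each windowed run) and `B14.RAssumedP244` at the Stage-13 carriers of record. [cite: Balaban1988Convergent, Thm 1 p.262; Theorem p.245; p.244; Balaban1989LargeFieldII, Thm 1 p.355] -/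
theorem thm1Printed_datumOfRecord₁₃SepMixed_of_thmP245I_rAssumedP244 {γ : ℝ} (hγ : 0 < γ)
    (T : (P : B12.RunParams) → (k : ℕ) → RTOpI (F.P P.K) k (SU N) (avOfRecord F N P.K k))
    (hTT : ∀ (P : B12.RunParams) (k : ℕ), k < P.K → (T P k).T (densOfRecord₁₃ F N θ P k) = tdensOfRecord₁₃ F N θ P k)
    (hT : ∀ P : B12.RunParams, ((datumOfRecord₁₃SepMixed F N θ h).C P).flow.InInterval γ P.K →
      B14.ThmP245PrintedI (T P) (densOfRecord₁₃ F N θ P) (VOfRecord₁₃ F N θ P).S (VOfRecord₁₃ F N θ P).Scorr P.K)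
    (hR : ∀ P : B12.RunParams, ((datumOfRecord₁₃SepMixed F N θ h).C P).flow.InInterval γ P.K →
      B14.RAssumedP244 (VOfRecord₁₃ F N θ P).R (VOfRecord₁₃ F N θ P).Scorr (VOfRecord₁₃ F N θ P).S P.K) :
    B16.Thm1Printed (datumOfRecord₁₃SepMixed F N θ h).C :=
  thm1Printed_datumOfRecord₁₃SepMixed_of_laws_rAssumedP244 F N θ h hγ
    (fun P hP => (B14NodeKnitRecord13R.thmP245PrintedI_at_record₁₃_iff_laws F N θ P (T P) (hTT P)).1 (hT P hP)) hR

/-- **★ ON THE LIVE-SELECTOR LINE, at the v1.2 datum: `B16.Thm1Printed` FROM [III]'s THEOREM OF p. 245 IN [III]'s OWN NAME WITH THE `ROpLeaf` SUPPLIED** (§1).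
[cite: Balaban1988Convergent, Theorem p.245, Thm 1 p.262, p.244; Balaban1989LargeFieldII, Thm 1 p.355; Balaban1989LargeFieldI, (0.3) p.176, p.177 (i)–(ii)] -/
theorem thm1Printed_datumOfRecord₁₃SepMixed_of_thmP245I_of_liveSel (hθ : θ.Admissible F N) (hκ : 0 ≤ θ.s2.lf.κ) (hE₀ : 0 ≤ θ.s2.lf.E₀) (hB₀ : 0 ≤ θ.s2.lf.B₀)
    (hsel : θ.ppSel = ppSelLiveOfRecord F N θ.ν θ.τ9 (EOfRecord₁₃ F N θ) (wOfRecord₉ F N θ.toStage9Params)) {γ : ℝ} (hγ : 0 < γ)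
    (T : (P : B12.RunParams) → (k : ℕ) → RTOpI (F.P P.K) k (SU N) (avOfRecord F N P.K k))
    (hTT : ∀ (P : B12.RunParams) (k : ℕ), k < P.K → (T P k).T (densOfRecord₁₃ F N θ P k) = tdensOfRecord₁₃ F N θ P k)
    (hT : ∀ P : B12.RunParams, ((datumOfRecord₁₃SepMixed F N θ h).C P).flow.InInterval γ P.K →
      B14.ThmP245PrintedI (T P) (densOfRecord₁₃ F N θ P) (VOfRecord₁₃ F N θ P).S (VOfRecord₁₃ F N θ P).Scorr P.K) :
    B16.Thm1Printed (datumOfRecord₁₃SepMixed F N θ h).C :=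
  thm1Printed_datumOfRecord₁₃SepMixed_of_thmP245I_rAssumedP244 F N θ h hγ T hTT hT
    (fun P _ => (B14NodeKnitRecord13R.rOpLeaf₁₃_iff_rAssumedP244 F N θ P).1 (rOpLeaf_VOfRecord₁₃_of_liveSel_sepMixed F N θ P h hθ hκ hE₀ hB₀ hsel))

/-- **★★ THE ROW AT THE WITNESS OF RECORD, v1.2 datum: `B16.Thm1Printed (datumOfRecord₁₃SepMixed F N θ₁₃ h).C`, `θ₁₃ = theta13LiveOfRecord F N`, FROM [III]'s THEOREM OF p. 245 IN
ITS OWN NAME ALONE** (the `ROpLeaf` is the closed theorem `rOpLeaf_VOfRecord₁₃_theta13LiveOfRecord`; the datum binder `h : Provisos₁₃SepMixed θ₁₃` is K0⁗'s).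
[cite: Balaban1988Convergent, Theorem p.245, Thm 1 p.262, p.244; Balaban1989LargeFieldII, Thm 1 p.355; Balaban1989LargeFieldI, (0.3) p.176, p.177 (i)–(ii)] -/
theorem thm1Printed_datumOfRecord₁₃SepMixed_theta13LiveOfRecord_of_thmP245I (hrec : (theta13LiveOfRecord F N).Provisos₁₃SepMixed F N) {γ : ℝ} (hγ : 0 < γ)
    (T : (P : B12.RunParams) → (k : ℕ) → RTOpI (F.P P.K) k (SU N) (avOfRecord F N P.K k))
    (hTT : ∀ (P : B12.RunParams) (k : ℕ), k < P.K →
      (T P k).T (densOfRecord₁₃ F N (theta13LiveOfRecord F N) P k) = tdensOfRecord₁₃ F N (theta13LiveOfRecord F N) P k)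
    (hT : ∀ P : B12.RunParams, ((datumOfRecord₁₃SepMixed F N (theta13LiveOfRecord F N) hrec).C P).flow.InInterval γ P.K →
      B14.ThmP245PrintedI (T P) (densOfRecord₁₃ F N (theta13LiveOfRecord F N) P) (VOfRecord₁₃ F N (theta13LiveOfRecord F N) P).S
        (VOfRecord₁₃ F N (theta13LiveOfRecord F N) P).Scorr P.K) :
    B16.Thm1Printed (datumOfRecord₁₃SepMixed F N (theta13LiveOfRecord F N) hrec).C :=
  thm1Printed_datumOfRecord₁₃SepMixed_of_thmP245I_rAssumedP244 F N (theta13LiveOfRecord F N) hrec hγ T hTT hT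
    (fun P _ => (B14NodeKnitRecord13R.rOpLeaf₁₃_iff_rAssumedP244 F N _ P).1 (rOpLeaf_VOfRecord₁₃_theta13LiveOfRecord F N P))

end Thm1PrintedNamed

/-! ## §6  KEYED on the v1.2 (D, w)-interface `IsRecordOfRecord₁₃CSepMixed`: Theorem 1's conclusion at every run, relative to the world's OWN 𝐑-leaves -/

section KeyedSep

variable {F N}
variable {D : FiniteEpsData F (SU N)} {w : WorldP}

/-- **THEOREM 1's CONCLUSION AT EVERY RUN OF A v1.2 STAGE-13 RECORD, RELATIVE TO 𝐑 AND THE THEOREM OF p. 245** (the (D, w)-face): the record PRESENTS `θ` with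
`Provisos₁₃SepMixed` and `D = datumOfRecord₁₃SepMixed θ hP`; at every run the world's own `rOperation` antecedent (N13's product; the leaf by the C-binding) and the Theorem of
p. 245 at the presenting objects give `(leavesP w P).densitiesDescribed`. [cite: Balaban1988Convergent, Thm 1 p.262; Theorem p.245; p.244; Balaban1989LargeFieldII, Thm 1 p.355 (bookkeeping)] -/
theorem densitiesDescribed_of_isRecordOfRecord₁₃CSepMixed_of_rOperation (hrec : IsRecordOfRecord₁₃CSepMixed F N D w) :
    ∃ (θ : Stage13Params F N) (hP : θ.Provisos₁₃SepMixed F N), θ.Admissible F N ∧ D = datumOfRecord₁₃SepMixed F N θ hP ∧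
      ∀ P : B12.RunParams, (leavesP w P).rOperation → (∀ k, k < P.K → SLaw₁₃ F N θ P k → TLaw₁₃ F N θ P k) →
        (leavesP w P).densitiesDescribed := by
  obtain ⟨θ, hP, hθ, hD, hC, -, -, hup⟩ := hrec
  refine ⟨θ, hP, hθ, hD, fun P hrop hT => ?_⟩
  exact densitiesDescribed_at_record₁₃SepMixed_of_laws F N θ P w hP (by rw [hC, hD])
    ((rOpLeaf_VOfRecord₁₃_iff F N θ P).1 ((B14NodeKnitRecord13R.rOperation_iff_rOpLeaf₁₃ F N θ w P (hup P)).1 hrop)) hT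

end KeyedSep

/-! ## §8  N11's PER-LEVEL SHARE ON PRINT'S RANGE: the §2 dichotomy of `𝐓ρ_k`'s slots is needed only at sequences that are LIVE **and** `Sect2.SeqSeparated`
(a live sequence has a non-zero 𝐓-slot, hence is separated — `…B14SeparationOfRecord`), under `0 < M₁ ≤ M` (K0a's witnesses: `M₁ = M = 1`) -/

section PrintRange

variable (θ : Stage13Params F N) (p : B12.RunParams)

/-- **★ AT THE LIVE SELECTOR: `TLaw` AT THE LIVE ∧ SEPARATED SEQUENCES ONLY ⇒ `SLaw₁₃ (k+1)`** (`0 < M₁ ≤ M`; from `Provisos₁₃SepMixed`'s row `rstep`): N11's per-level share of Theorem 1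
on the witness line, stated ON PRINT'S RANGE — the §2 dichotomy of `𝐓ρ_k`'s slots is demanded only at sequences that carry fibre mass AND are admissible in the sense of
[6] (1.3)–(1.6); the 𝐓-image laws at every sequence. [cite: Balaban1988Convergent, §2 p.262, Thm 2 p.263, (3.24)–(3.25) p.270, p.256; Balaban1989LargeFieldI, (0.3) p.176, p.177 (i)–(ii); Balaban1985RegularSpaces, (1.3)–(1.6) p.77] -/
theorem sLaw₁₃_succ_of_tLawLiveSep_of_liveSel_sepMixed (h : θ.Provisos₁₃SepMixed F N) (hθ : θ.Admissible F N) (hκ : 0 ≤ θ.s2.lf.κ) (hE₀ : 0 ≤ θ.s2.lf.E₀)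
    (hB₀ : 0 ≤ θ.s2.lf.B₀) (hM₁ : 0 < θ.ν.M₁) (hle : θ.ν.M₁ ≤ θ.τ9.M)
    (hsel : θ.ppSel = ppSelLiveOfRecord F N θ.ν θ.τ9 (EOfRecord₁₃ F N θ) (wOfRecord₉ F N θ.toStage9Params)) (k : ℕ) (hk : k < p.K)
    (hT : ∃ (t : SeqOfRecord F θ.ν θ.τ9.M (gOfRecord₁₃ F N θ p) p.K (k + 1) → Sect2.TermValues (F.P p.K) (MatA N) (FluctV N) θ.τ9.M)
      (Ek : SeqOfRecord F θ.ν θ.τ9.M (gOfRecord₁₃ F N θ p) p.K (k + 1) → ℝ), Sect2.UniversalE t ∧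
      ∀ s, Sect2.LawsT (sect2TowerOfRecord F N (FluctV N) p.K (settingOfRecord₁₃ F N θ p) (θ.Rz p.K) s (t s)) (settingOfRecord₁₃ F N θ p).lf
          (settingOfRecord₁₃ F N θ p).βc k ∧
        (LiveSeq F N θ.ν θ.τ9 p (gOfRecord₁₃ F N θ p) (k + 1)
            (slotsTOfRecord F N θ.ν θ.τ9 (EOfRecord₁₃ F N θ) (wOfRecord₉ F N θ.toStage9Params) θ.ppSel p (gOfRecord₁₃ F N θ p) (k + 1)) s →
          Sect2.SeqSeparated θ.ν.M₁ s →
          (slotsTOfRecord F N θ.ν θ.τ9 (EOfRecord₁₃ F N θ) (wOfRecord₉ F N θ.toStage9Params) θ.ppSel p (gOfRecord₁₃ F N θ p) (k + 1) s = 0 ∨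
            ∀ᵐ V ∂(fieldMeasure (F.P p.K) (k + 1) (SU N)), chiSeqOfRecord F N θ.ν θ.τ9.M (gOfRecord₁₃ F N θ p) p.K (k + 1) s V ≠ 0 →
              slotsTOfRecord F N θ.ν θ.τ9 (EOfRecord₁₃ F N θ) (wOfRecord₉ F N θ.toStage9Params) θ.ppSel p (gOfRecord₁₃ F N θ p) (k + 1) s V
                = sect2Slot F N (FluctV N) p.K (settingOfRecord₁₃ F N θ p) (θ.Rz p.K) (WtOfRecord₁₃ F N θ p) s (t s) (Ek s)
                    (UbgOfRecord₁₃ F N θ p (k + 1) s) V))) :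
    SLaw₁₃ F N θ p (k + 1) := by
  obtain ⟨t, Ek, hu, hs⟩ := hT
  exact sLaw₁₃_succ_of_tLawLiveSeq_of_liveSel_of_rstep F N θ p (rstep_of_provisos₁₃SepMixed h) hθ hκ hE₀ hB₀ hsel k hk
    ⟨t, Ek, hu, fun s => ⟨(hs s).1, fun hl => (hs s).2 hl (B16RLeafRecord13Sep.seqSeparated_of_liveSeq₁₃ F N θ p hM₁ hle k s hl)⟩⟩

/-- **★ THEOREM 1 [III] AT THE LIVE SELECTOR FROM (S1ᵀ) ON PRINT'S RANGE** (live ∧ separated sequences only; `0 < M₁ ≤ M`): `∀ k ≤ K, SLaw₁₃ θ p k`.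
[cite: Balaban1988Convergent, Thm 1 p.262; Theorem p.245; p.244, p.256; Balaban1989LargeFieldI, (0.3) p.176, p.177 (i)–(ii); Balaban1985RegularSpaces, (1.3)–(1.6) p.77] -/
theorem sLaw₁₃_all_of_thmP245LiveSep_of_liveSel_sepMixed (h : θ.Provisos₁₃SepMixed F N) (hθ : θ.Admissible F N) (hκ : 0 ≤ θ.s2.lf.κ) (hE₀ : 0 ≤ θ.s2.lf.E₀)
    (hB₀ : 0 ≤ θ.s2.lf.B₀) (hM₁ : 0 < θ.ν.M₁) (hle : θ.ν.M₁ ≤ θ.τ9.M)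
    (hsel : θ.ppSel = ppSelLiveOfRecord F N θ.ν θ.τ9 (EOfRecord₁₃ F N θ) (wOfRecord₉ F N θ.toStage9Params))
    (hT : ∀ k, k < p.K → SLaw₁₃ F N θ p k →
      ∃ (t : SeqOfRecord F θ.ν θ.τ9.M (gOfRecord₁₃ F N θ p) p.K (k + 1) → Sect2.TermValues (F.P p.K) (MatA N) (FluctV N) θ.τ9.M)
      (Ek : SeqOfRecord F θ.ν θ.τ9.M (gOfRecord₁₃ F N θ p) p.K (k + 1) → ℝ), Sect2.UniversalE t ∧
      ∀ s, Sect2.LawsT (sect2TowerOfRecord F N (FluctV N) p.K (settingOfRecord₁₃ F N θ p) (θ.Rz p.K) s (t s)) (settingOfRecord₁₃ F N θ p).lf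
          (settingOfRecord₁₃ F N θ p).βc k ∧
        (LiveSeq F N θ.ν θ.τ9 p (gOfRecord₁₃ F N θ p) (k + 1)
            (slotsTOfRecord F N θ.ν θ.τ9 (EOfRecord₁₃ F N θ) (wOfRecord₉ F N θ.toStage9Params) θ.ppSel p (gOfRecord₁₃ F N θ p) (k + 1)) s →
          Sect2.SeqSeparated θ.ν.M₁ s →
          (slotsTOfRecord F N θ.ν θ.τ9 (EOfRecord₁₃ F N θ) (wOfRecord₉ F N θ.toStage9Params) θ.ppSel p (gOfRecord₁₃ F N θ p) (k + 1) s = 0 ∨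
            ∀ᵐ V ∂(fieldMeasure (F.P p.K) (k + 1) (SU N)), chiSeqOfRecord F N θ.ν θ.τ9.M (gOfRecord₁₃ F N θ p) p.K (k + 1) s V ≠ 0 →
              slotsTOfRecord F N θ.ν θ.τ9 (EOfRecord₁₃ F N θ) (wOfRecord₉ F N θ.toStage9Params) θ.ppSel p (gOfRecord₁₃ F N θ p) (k + 1) s V
                = sect2Slot F N (FluctV N) p.K (settingOfRecord₁₃ F N θ p) (θ.Rz p.K) (WtOfRecord₁₃ F N θ p) s (t s) (Ek s)
                    (UbgOfRecord₁₃ F N θ p (k + 1) s) V))) :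
    ∀ k, k ≤ p.K → SLaw₁₃ F N θ p k := by
  intro k
  induction k with
  | zero => exact fun _ => sLaw₁₃_zero F N θ p
  | succ n ih =>
    intro hk
    exact sLaw₁₃_succ_of_tLawLiveSep_of_liveSel_sepMixed F N θ p h hθ hκ hE₀ hB₀ hM₁ hle hsel n (Nat.lt_of_succ_le hk)
      (hT n (Nat.lt_of_succ_le hk) (ih (Nat.le_of_succ_le hk)))

end PrintRange

/-! ## §9  THE v1.3-KEYED NODE-CONCLUSION FACES of `…B16RLeafRecord13LiveSLaw` (the converse reading: `densitiesDescribed` ⇒ the `SLaw`-side clause) -/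

section ConverseFaces

variable (θ : Stage13Params F N) (p : B12.RunParams) (w : WorldP) (h : θ.Provisos₁₃SepMixed F N)

/-- **N11's conclusion at a world bound to the v1.3 datum IS `∀ k ≤ K, SLaw₁₃ θ p k`** (`…LiveSLaw.densitiesDescribed_leavesP_iff_sLaw₁₃_all` at `datumOfRecord₁₃SepMixed`'s `C`,
which is the proviso-free construction of record, `Node00.datumOfRecord₁₃SepMixed_C`). [cite: Balaban1988Convergent, Thm 1 p.262, (2.18) p.257 (bookkeeping at the record)] -/
theorem densitiesDescribed_leavesP_iff_sLaw₁₃_all_sepMixed (hC : w.C = (datumOfRecord₁₃SepMixed F N θ h).C) :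
    (leavesP w p).densitiesDescribed ↔ ∀ k, k ≤ p.K → SLaw₁₃ F N θ p k :=
  B16RLeafRecord13LiveSLaw.densitiesDescribed_leavesP_iff_sLaw₁₃_all F N θ p w (by rw [hC]; rfl)

/-- **At the live selector (K0b's residuals): `densitiesDescribed` at a v1.3-datum world ⇒ the `SLaw`-side guard-free clause at every no-expansion sequence of every
level `k < K`.** [cite: Balaban1988Convergent, Thm 1 p.262, (3.25) p.270, Theorem p.245, (3.16) p.268; Balaban1989LargeFieldI, (0.3)–(0.4) p.176] -/
theorem sLaw₁₃_succ_clause_of_Omega_empty_of_densitiesDescribed_of_liveSel_sepMixed (hC : w.C = (datumOfRecord₁₃SepMixed F N θ h).C)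
    (hres : θ.HasResidualsOfRecord F N)
    (hsel : θ.ppSel = ppSelLiveOfRecord F N θ.ν θ.τ9 (EOfRecord₁₃ F N θ) (wOfRecord₉ F N θ.toStage9Params))
    (hD : (leavesP w p).densitiesDescribed) {k : ℕ} (hk : k < p.K)
    (s : SeqOfRecord F θ.ν θ.τ9.M (gOfRecord₁₃ F N θ p) p.K (k + 1)) (hΩ : s.Ω (k + 1) = ∅) :
    ∃ (t : SeqOfRecord F θ.ν θ.τ9.M (gOfRecord₁₃ F N θ p) p.K (k + 1) → Sect2.TermValues (F.P p.K) (MatA N) (FluctV N) θ.τ9.M)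
      (Ek : SeqOfRecord F θ.ν θ.τ9.M (gOfRecord₁₃ F N θ p) p.K (k + 1) → ℝ),
      Sect2.UniversalE t ∧
      (∀ s', Sect2.LawsRT (sect2TowerOfRecord F N (FluctV N) p.K (settingOfRecord₁₃ F N θ p) (θ.Rz p.K) s' (t s'))
        (settingOfRecord₁₃ F N θ p).lf (k + 1)) ∧
      ((slotsTOfRecord F N θ.ν θ.τ9 (EOfRecord₁₃ F N θ) (wOfRecord₉ F N θ.toStage9Params) θ.ppSel p
          (gOfRecord₁₃ F N θ p) (k + 1) s =ᵐ[fieldMeasure (F.P p.K) (k + 1) (SU N)] 0) ∨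
        ∀ᵐ V' ∂fieldMeasure (F.P p.K) (k + 1) (SU N),
          slotsTOfRecord F N θ.ν θ.τ9 (EOfRecord₁₃ F N θ) (wOfRecord₉ F N θ.toStage9Params) θ.ppSel p
              (gOfRecord₁₃ F N θ p) (k + 1) s V' =
            sect2Slot F N (FluctV N) p.K (settingOfRecord₁₃ F N θ p) (θ.Rz p.K) (WtOfRecord₁₃ F N θ p) s (t s) (Ek s)
              (UbgOfRecord₁₃ F N θ p (k + 1) s) V') :=
  B16RLeafRecord13LiveSLaw.sLaw₁₃_succ_clause_of_Omega_empty_of_liveSel_of_hasResiduals F N θ p hres hsel hk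
    ((densitiesDescribed_leavesP_iff_sLaw₁₃_all_sepMixed F N θ p w h hC).1 hD (k + 1) hk) s hΩ

end ConverseFaces

section ConverseFacesOfRecord

variable (p : B12.RunParams) (w : WorldP) (h : (theta13LiveOfRecord F N).Provisos₁₃SepMixed F N)

/-- **★★★ At a world bound to the v1.3 datum OF THE WITNESS OF RECORD: N11's node conclusion ⇒ the `SLaw`-side clause at every no-expansion sequence, `k < K` —
no further hypothesis** (`…LiveSLaw.sLaw₁₃_succ_clause_of_Omega_empty_theta13LiveOfRecord`). [cite: Balaban1988Convergent, Thm 1 p.262, (3.25) p.270, Theorem p.245, (3.16) p.268, (3.22) p.269; Balaban1989LargeFieldI, (0.3)–(0.4) p.176] -/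
theorem sLaw₁₃_succ_clause_of_Omega_empty_of_densitiesDescribed_theta13LiveOfRecord_sepMixed
    (hC : w.C = (datumOfRecord₁₃SepMixed F N (theta13LiveOfRecord F N) h).C) (hD : (leavesP w p).densitiesDescribed) {k : ℕ} (hk : k < p.K)
    (s : SeqOfRecord F (theta13LiveOfRecord F N).ν (theta13LiveOfRecord F N).τ9.M (gOfRecord₁₃ F N (theta13LiveOfRecord F N) p) p.K (k + 1))
    (hΩ : s.Ω (k + 1) = ∅) :
    ∃ (t : SeqOfRecord F (theta13LiveOfRecord F N).ν (theta13LiveOfRecord F N).τ9.M (gOfRecord₁₃ F N (theta13LiveOfRecord F N) p) p.K (k + 1) →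
        Sect2.TermValues (F.P p.K) (MatA N) (FluctV N) (theta13LiveOfRecord F N).τ9.M)
      (Ek : SeqOfRecord F (theta13LiveOfRecord F N).ν (theta13LiveOfRecord F N).τ9.M (gOfRecord₁₃ F N (theta13LiveOfRecord F N) p) p.K (k + 1) → ℝ),
      Sect2.UniversalE t ∧
      (∀ s', Sect2.LawsRT (sect2TowerOfRecord F N (FluctV N) p.K (settingOfRecord₁₃ F N (theta13LiveOfRecord F N) p) ((theta13LiveOfRecord F N).Rz p.K) s' (t s'))
        (settingOfRecord₁₃ F N (theta13LiveOfRecord F N) p).lf (k + 1)) ∧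
      ((slotsTOfRecord F N (theta13LiveOfRecord F N).ν (theta13LiveOfRecord F N).τ9 (EOfRecord₁₃ F N (theta13LiveOfRecord F N))
          (wOfRecord₉ F N (theta13LiveOfRecord F N).toStage9Params) (theta13LiveOfRecord F N).ppSel p
          (gOfRecord₁₃ F N (theta13LiveOfRecord F N) p) (k + 1) s =ᵐ[fieldMeasure (F.P p.K) (k + 1) (SU N)] 0) ∨
        ∀ᵐ V' ∂fieldMeasure (F.P p.K) (k + 1) (SU N),
          slotsTOfRecord F N (theta13LiveOfRecord F N).ν (theta13LiveOfRecord F N).τ9 (EOfRecord₁₃ F N (theta13LiveOfRecord F N))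
              (wOfRecord₉ F N (theta13LiveOfRecord F N).toStage9Params) (theta13LiveOfRecord F N).ppSel p
              (gOfRecord₁₃ F N (theta13LiveOfRecord F N) p) (k + 1) s V' =
            sect2Slot F N (FluctV N) p.K (settingOfRecord₁₃ F N (theta13LiveOfRecord F N) p) ((theta13LiveOfRecord F N).Rz p.K)
              (WtOfRecord₁₃ F N (theta13LiveOfRecord F N) p) s (t s) (Ek s)
              (UbgOfRecord₁₃ F N (theta13LiveOfRecord F N) p (k + 1) s) V') :=
  B16RLeafRecord13LiveSLaw.sLaw₁₃_succ_clause_of_Omega_empty_theta13LiveOfRecord F N p hk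
    ((densitiesDescribed_leavesP_iff_sLaw₁₃_all_sepMixed F N (theta13LiveOfRecord F N) p w h hC).1 hD (k + 1) hk) s hΩ

/-- **★★★ … and from a non-vacuous N11 conjunct `Dag.B14_main (leavesP w p)` at that world** (in-edge leaves, small-field implication, flow control, interval hypothesis
read TRUE; the `rOperation` antecedent is the closed theorem `…LiveRstep.rOperation_leavesP_theta13LiveOfRecord`). [cite: Balaban1988Convergent, Thm 1 p.262, (3.25) p.270, Theorem p.245, p.244, (3.16) p.268; Balaban1989LargeFieldI, (0.3)–(0.4) p.176] -/
theorem sLaw₁₃_succ_clause_of_Omega_empty_of_b14_main_theta13LiveOfRecord_sepMixed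
    (hC : w.C = (datumOfRecord₁₃SepMixed F N (theta13LiveOfRecord F N) h).C)
    (hup : w.up p = upOfRecord₅C F N ((theta13LiveOfRecord F N).toStage5₁₃ F N) p) (h14 : Dag.B14_main (leavesP w p))
    (h7 : (leavesP w p).b7) (h8 : (leavesP w p).b8) (h9 : (leavesP w p).b9) (h10 : (leavesP w p).b10) (h11 : (leavesP w p).b11)
    (hsf : (leavesP w p).smallCouplings → (leavesP w p).smallFieldInductive) (hfc : (leavesP w p).smallCouplings → (leavesP w p).flowControl)
    (hsc : (leavesP w p).smallCouplings) {k : ℕ} (hk : k < p.K)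
    (s : SeqOfRecord F (theta13LiveOfRecord F N).ν (theta13LiveOfRecord F N).τ9.M (gOfRecord₁₃ F N (theta13LiveOfRecord F N) p) p.K (k + 1))
    (hΩ : s.Ω (k + 1) = ∅) :
    ∃ (t : SeqOfRecord F (theta13LiveOfRecord F N).ν (theta13LiveOfRecord F N).τ9.M (gOfRecord₁₃ F N (theta13LiveOfRecord F N) p) p.K (k + 1) →
        Sect2.TermValues (F.P p.K) (MatA N) (FluctV N) (theta13LiveOfRecord F N).τ9.M)
      (Ek : SeqOfRecord F (theta13LiveOfRecord F N).ν (theta13LiveOfRecord F N).τ9.M (gOfRecord₁₃ F N (theta13LiveOfRecord F N) p) p.K (k + 1) → ℝ),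
      Sect2.UniversalE t ∧
      (∀ s', Sect2.LawsRT (sect2TowerOfRecord F N (FluctV N) p.K (settingOfRecord₁₃ F N (theta13LiveOfRecord F N) p) ((theta13LiveOfRecord F N).Rz p.K) s' (t s'))
        (settingOfRecord₁₃ F N (theta13LiveOfRecord F N) p).lf (k + 1)) ∧
      ((slotsTOfRecord F N (theta13LiveOfRecord F N).ν (theta13LiveOfRecord F N).τ9 (EOfRecord₁₃ F N (theta13LiveOfRecord F N))
          (wOfRecord₉ F N (theta13LiveOfRecord F N).toStage9Params) (theta13LiveOfRecord F N).ppSel p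
          (gOfRecord₁₃ F N (theta13LiveOfRecord F N) p) (k + 1) s =ᵐ[fieldMeasure (F.P p.K) (k + 1) (SU N)] 0) ∨
        ∀ᵐ V' ∂fieldMeasure (F.P p.K) (k + 1) (SU N),
          slotsTOfRecord F N (theta13LiveOfRecord F N).ν (theta13LiveOfRecord F N).τ9 (EOfRecord₁₃ F N (theta13LiveOfRecord F N))
              (wOfRecord₉ F N (theta13LiveOfRecord F N).toStage9Params) (theta13LiveOfRecord F N).ppSel p
              (gOfRecord₁₃ F N (theta13LiveOfRecord F N) p) (k + 1) s V' =
            sect2Slot F N (FluctV N) p.K (settingOfRecord₁₃ F N (theta13LiveOfRecord F N) p) ((theta13LiveOfRecord F N).Rz p.K)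
              (WtOfRecord₁₃ F N (theta13LiveOfRecord F N) p) s (t s) (Ek s)
              (UbgOfRecord₁₃ F N (theta13LiveOfRecord F N) p (k + 1) s) V') :=
  sLaw₁₃_succ_clause_of_Omega_empty_of_densitiesDescribed_theta13LiveOfRecord_sepMixed F N p w h hC
    (h14 h7 h8 h9 h10 h11 hsf hfc (rOperation_leavesP_theta13LiveOfRecord F N p w hup) hsc) hk s hΩ

end ConverseFacesOfRecord

end Literature.MathematicalPhysics.QuantumFieldTheory.Balaban1983to89.B16RLeafRecord13SepMixed
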